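import Mathlib
import Summits.KontsevichZagierPeriods.Zeta5Search.LongClassCarries52
import Summits.KontsevichZagierPeriods.Zeta5Search.SecondOrderLive
import HarnessLib

/-!
# ζ(5) search — long classes of the record ray IV: THE STRUCTURE THEOREM of the window `M = 52` (`longClass52`)

Cell `pub-zeta5` (HONEST FRAMING: systematic search; no irrationality claim unless certified), typer seat generation 13.
For `n < p ≤ 25n/24` (`δ = p − n`, `24δ ≤ n`) and a residue `x < p`, the levels of the class of `x` in `b(n)` are
`x + kp = (k + c_k)·n + r_k` with the CARRIES `c_k = ⌊(x + kδ)/n⌋`: non-decreasing, steps `≤ 1`, `c_{k+24} ≤ c_k + 1`, `c₀ ≤ 1`,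
`c_{L+1} ≤ 2`.  Hence `c_k = c₀ + [k ≥ k₁] + [k ≥ k₂]` with the jump levels `k₁ ≤ k₂` (`Nat.find`), exact multiples of `n` occur
only at jump levels, the even centre at most once; together with `netExp_bRec_eq` this identifies the type list of the class with
`F52` of a coded tuple and proves the constraints `N52` (`longClass52`).  Integer bookkeeping; nothing here bears on irrationality.
-/

namespace Summit.KontsevichZagierPeriods.Zeta5Search.LongClass

open Finset
open Summit.KontsevichZagierPeriods.Zeta5Search.ClusterValuation (netExp bRec CentreIn)
open Summit.KontsevichZagierPeriods.Zeta5Search.SecondOrder (topLevel classTypeList classTypeList_level level_bounds')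
open Summit.KontsevichZagierPeriods.Zeta5Search.CellKit

variable {p : ℕ} [hp : Fact p.Prime]

/-! ## The structure theorem -/

section Cls

variable (n x : ℕ) (hnp : n < p) (hw : 24 * p ≤ 25 * n) (hx : x < p)
include hnp hw hx

/-- **THE STRUCTURE THEOREM (window `M = 52`).**  The type list of every class `x < p` of `b(n)` is `F52` of a coded tuple
satisfying `N52`, whose top level is `topLevel`, whose centre code records the even centre, and the class data in range. -/
theorem longClass52 :
    ∃ c0 u k1 d e1 e2 kc : ℕ, c0 ≤ 1 ∧ u ≤ 2 ∧ e1 ≤ 1 ∧ e2 ≤ 1 ∧ kc ≤ 1 ∧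
      ((k1 = 41 ∧ d = 18 ∧ e1 = 0 ∧ e2 = 0) ∨ (k1 ≤ 40 ∧ d = 18 ∧ e2 = 0) ∨ (k1 ≤ 17 ∧ d ≤ 17)) ∧
      N52 (mk52 c0 u k1 d e1 e2 kc) = true ∧
      (mk52 c0 u k1 d e1 e2 kc).L = topLevel (bRec n) p x ∧
      classTypeList (bRec n) p x = F52 (mk52 c0 u k1 d e1 e2 kc) ∧
      ((mk52 c0 u k1 d e1 e2 kc).kap ≤ topLevel (bRec n) p x ↔ ∃ k ≤ topLevel (bRec n) p x, 2 * (x + k * p) = 41 * n) := by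
  -- the window arithmetic
  have hp0 : 0 < p := hp.out.pos
  obtain ⟨δ, hpδ⟩ : ∃ δ, p = n + δ := ⟨p - n, by omega⟩
  have hδ1 : 1 ≤ δ := by omega
  have hδ24 : 24 * δ ≤ n := by omega
  have hn0 : 0 < n := by omega
  have hn1 : 1 ≤ n := hn0
  have hb0 := CellA.bRec_zero_toNat n
  have hxn : x ≤ (bRec n 0).toNat := by rw [hb0]; omega
  obtain ⟨hL, hL'⟩ := level_bounds' (p := p) (bRec n) hxn
  rw [hb0] at hL hL'
  set L := topLevel (bRec n) p x with hLdef
  -- carries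
  set c : ℕ → ℕ := carry n δ x with hcdef
  set r : ℕ → ℕ := rem n δ x with hrdef
  have hlev : ∀ k, x + k * p = (k + c k) * n + r k := fun k => by rw [hpδ]; exact level_eq n δ x k
  have hdm : ∀ k, (x + k * p) / n = k + c k ∧ (x + k * p) % n = r k := fun k => by rw [hpδ]; exact level_div_mod hn0 δ x k
  have hrlt : ∀ k, r k < n := fun k => Nat.mod_lt _ hn0
  have cmono : ∀ {k k'}, k ≤ k' → c k ≤ c k' := fun h => carry_mono n δ x h
  have cstep : ∀ k, c (k + 1) ≤ c k + 1 := fun k => carry_add_le hn0 (m := 1) (by omega) k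
  have c24 : ∀ k, c (k + 24) ≤ c k + 1 := fun k => carry_add_le hn0 (m := 24) (by omega) k
  have hc0 : c 0 ≤ 1 := by
    show carry n δ x 0 ≤ 1
    unfold carry; rw [zero_mul, add_zero]
    exact Nat.lt_succ_iff.1 ((Nat.div_lt_iff_lt_mul hn0).2 (by omega))
  have hL40 : L ≤ 40 := by
    by_contra h
    have : 41 * p ≤ L * p := Nat.mul_le_mul_right p (by omega)
    nlinarith
  have hcL1 : c (L + 1) ≤ 2 := by
    show carry n δ x (L + 1) ≤ 2
    unfold carry
    have : (L + 1) * δ ≤ 41 * δ := Nat.mul_le_mul_right δ (by omega)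
    exact Nat.lt_succ_iff.1 ((Nat.div_lt_iff_lt_mul hn0).2 (by omega))
  have hcL : c L ≤ 2 := (cmono (Nat.le_succ L)).trans hcL1
  -- the jump levels
  have hex1 : ∃ k, L < k ∨ c 0 < c k := ⟨L + 1, Or.inl (Nat.lt_succ_self L)⟩
  have hex2 : ∃ k, L < k ∨ c 0 + 1 < c k := ⟨L + 1, Or.inl (Nat.lt_succ_self L)⟩
  set k₁ := Nat.find hex1 with hk₁def
  set k₂ := Nat.find hex2 with hk₂def
  have hk₁L : k₁ ≤ L + 1 := Nat.find_min' hex1 (Or.inl (Nat.lt_succ_self L))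
  have hk₂L : k₂ ≤ L + 1 := Nat.find_min' hex2 (Or.inl (Nat.lt_succ_self L))
  have hk₁1 : 1 ≤ k₁ := by
    by_contra h
    have h0 : k₁ = 0 := by omega
    have := Nat.find_spec hex1
    rw [← hk₁def, h0] at this
    omega
  have below1 : ∀ k, k < k₁ → c k = c 0 := fun k hk => by
    have := Nat.find_min hex1 (hk₁def ▸ hk)
    push Not at this
    exact le_antisymm this.2 (cmono (Nat.zero_le k))
  have above1 : ∀ k, k₁ ≤ k → k ≤ L → c 0 + 1 ≤ c k := fun k hk hkL => by
    have hs := Nat.find_spec hex1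
    rw [← hk₁def] at hs
    rcases hs with hs | hs
    · omega
    · exact (Nat.succ_le_of_lt hs).trans (cmono hk)
  have below2 : ∀ k, k < k₂ → c k ≤ c 0 + 1 := fun k hk => by
    have := Nat.find_min hex2 (hk₂def ▸ hk)
    push Not at this
    exact this.2
  have above2 : ∀ k, k₂ ≤ k → k ≤ L → c 0 + 2 ≤ c k := fun k hk hkL => by
    have hs := Nat.find_spec hex2
    rw [← hk₂def] at hs
    rcases hs with hs | hs
    · omega
    · exact (Nat.succ_le_of_lt hs).trans (cmono hk)
  have hk₁₂ : k₁ ≤ k₂ := by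
    by_contra h
    have h1 := below1 k₂ (by omega)
    have h2 := above2 k₂ le_rfl (by omega)
    omega
  -- the representation of the carries
  have hrep : ∀ k, k ≤ L → c k = c 0 + (if k₁ ≤ k then 1 else 0) + (if k₂ ≤ k then 1 else 0) := by
    intro k hk
    by_cases h1 : k₁ ≤ k
    · by_cases h2 : k₂ ≤ k
      · rw [if_pos h1, if_pos h2]
        have := above2 k h2 hk; have := (cmono hk).trans hcL; omega
      · rw [if_pos h1, if_neg h2, add_zero]
        have := above1 k h1 hk; have := below2 k (by omega); omega
    · rw [if_neg h1, if_neg (by omega), add_zero, add_zero]; exact below1 k (by omega)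
  -- exact multiples sit at jump levels
  have hflag : ∀ k, 1 ≤ k → k ≤ L → r k = 0 → k = k₁ ∨ k = k₂ := by
    intro k hk1 hkL hr0
    have hj := carry_jump_of_rem_zero (x := x) hδ1 (by omega) hk1 hr0
    have e1 := hrep k hkL
    have e2 := hrep (k - 1) (by omega)
    change c (k - 1) + 1 = c k at hj
    by_contra hne
    push Not at hne
    rw [e1, e2] at hj
    rcases Nat.lt_or_ge k k₁ with h1 | h1
    · rw [if_neg (by omega), if_neg (by omega), if_neg (by omega), if_neg (by omega)] at hj; omega
    · rcases Nat.lt_or_ge k k₂ with h2 | h2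
      · rw [if_pos (by omega), if_neg (by omega), if_pos h1, if_neg (by omega)] at hj; omega
      · rw [if_pos (by omega), if_pos (by omega), if_pos h1, if_pos h2] at hj; omega
  -- the even centre
  have hexκ : ∃ k, L < k ∨ 2 * (x + k * p) = 41 * n := ⟨L + 1, Or.inl (Nat.lt_succ_self L)⟩
  set κ := Nat.find hexκ with hκdef
  have hκL : κ ≤ L + 1 := Nat.find_min' hexκ (Or.inl (Nat.lt_succ_self L))
  have hcen : ∀ k, k ≤ L → (2 * (x + k * p) = 41 * n ↔ k = κ) := by
    intro k hk
    constructor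
    · intro h
      have hle : κ ≤ k := Nat.find_min' hexκ (Or.inr h)
      rcases hle.lt_or_eq with hlt | heq
      · have hs := Nat.find_spec hexκ
        rw [← hκdef] at hs
        rcases hs with hs | hs
        · omega
        · exfalso
          have : κ * p < k * p := Nat.mul_lt_mul_of_pos_right hlt hp0
          omega
      · exact heq.symm
    · intro h
      subst h
      have hs := Nat.find_spec hexκ
      rw [← hκdef] at hs
      exact hs.resolve_left (by omega)
  -- brackets of the top levels
  have hβL : (x + L * p) / n = L + c L := (hdm L).1
  have hβL41 : L + c L ≤ 41 := by rw [← hβL]; exact Nat.div_le_of_le_mul (by linarith)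
  have hβL39 : 39 ≤ L + c L := by rw [← hβL]; exact (Nat.le_div_iff_mul_le hn0).2 (by omega)
  have hβL1 : 41 ≤ L + 1 + c (L + 1) := by rw [← (hdm (L + 1)).1]; exact (Nat.le_div_iff_mul_le hn0).2 (by nlinarith)
  -- ### auxiliary bounds
  have hL38 : 38 ≤ L := by omega
  have hc23 : c 0 = 1 → c 23 ≤ 1 := fun _ => by
    show carry n δ x 23 ≤ 1
    unfold carry
    exact Nat.lt_succ_iff.1 ((Nat.div_lt_iff_lt_mul hn0).2 (by omega))
  have hsp : k₂ ≤ L → k₁ + 24 ≤ k₂ := fun h2 => by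
    by_contra hlt
    have e0 := below1 (k₁ - 1) (by omega)
    have ea := above2 k₂ le_rfl h2
    have := c24 (k₁ - 1)
    have := cmono (show k₂ ≤ k₁ - 1 + 24 by omega)
    omega
  -- ### the codes
  set u := L - 38 with hu
  set k1c := (if k₁ ≤ L then k₁ else 41) with hk1c
  set dc := (if k₂ ≤ L then k₂ - k₁ - 24 else 18) with hdc
  set e1c := (if k₁ ≤ L ∧ r k₁ = 0 then 1 else 0) with he1c
  set e2c := (if k₂ ≤ L ∧ r k₂ = 0 then 1 else 0) with he2c
  set kcc := (if κ ≤ L then 1 else 0) with hkcc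
  set T := mk52 (c 0) u k1c dc e1c e2c kcc with hT
  -- the fields of `T`
  have hTL : T.L = L := by show 38 + u = L; omega
  have hTc0 : T.c0 = c 0 := rfl
  have hTk1 : T.k1 = k1c := rfl
  have hTk2 : T.k2 = (if dc = 18 then 38 + u + 1 else k1c + 24 + dc) := rfl
  have hTe1 : T.e1 = (e1c == 1) := rfl
  have hTe2 : T.e2 = (e2c == 1) := rfl
  -- the two "present" predicates
  have hk1_le : ∀ k, k ≤ L → (T.k1 ≤ k ↔ k₁ ≤ k) := fun k hk => by
    rw [hTk1, hk1c]; split_ifs with h <;> constructor <;> intro h' <;> omega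
  have hk2_val : (k₂ ≤ L → T.k2 = k₂) ∧ (¬ k₂ ≤ L → T.k2 = L + 1) := by
    refine ⟨fun h2 => ?_, fun h2 => ?_⟩
    · have h1 : k₁ ≤ L := hk₁₂.trans h2
      have := hsp h2
      rw [hTk2, hdc, if_pos h2, if_neg (by omega), hk1c, if_pos h1]; omega
    · rw [hTk2, hdc, if_neg h2, if_pos rfl]; omega
  have hk2_le : ∀ k, k ≤ L → (T.k2 ≤ k ↔ k₂ ≤ k) := fun k hk => by
    by_cases h2 : k₂ ≤ L
    · rw [hk2_val.1 h2]
    · rw [hk2_val.2 h2]; constructor <;> intro h' <;> omega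
  have hTcarry : ∀ k, k ≤ L → T.carry k = c k := fun k hk => by
    rw [hrep k hk, Tup.carry, hTc0]
    have e1 : (if T.k1 ≤ k then 1 else 0) = (if k₁ ≤ k then 1 else 0) := if_congr (hk1_le k hk) rfl rfl
    have e2 : (if T.k2 ≤ k then 1 else 0) = (if k₂ ≤ k then 1 else 0) := if_congr (hk2_le k hk) rfl rfl
    rw [e1, e2]
  have hTe1_iff : T.e1 = true ↔ (k₁ ≤ L ∧ r k₁ = 0) := by
    rw [hTe1, he1c]; split_ifs with h <;> simp [h]
  have hTe2_iff : T.e2 = true ↔ (k₂ ≤ L ∧ r k₂ = 0) := by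
    rw [hTe2, he2c]; split_ifs with h <;> simp [h]
  -- the flags
  have hTflag : ∀ k, 1 ≤ k → k ≤ L → T.flag k = decide (r k = 0) := fun k hk1 hk => by
    by_cases hr0 : r k = 0
    · rw [decide_eq_true hr0]
      unfold Tup.flag
      rw [Bool.or_eq_true]
      rcases hflag k hk1 hk hr0 with h | h
      · left
        have h1 : k₁ ≤ L := by omega
        rw [Bool.and_eq_true, hTe1_iff, hTk1, hk1c, if_pos h1]
        exact ⟨by simp [h], h1, h ▸ hr0⟩
      · right
        have h2 : k₂ ≤ L := by omega
        rw [Bool.and_eq_true, hTe2_iff, hk2_val.1 h2]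
        exact ⟨by simp [h], h2, h ▸ hr0⟩
    · rw [decide_eq_false hr0]
      unfold Tup.flag
      rw [Bool.or_eq_false_iff, Bool.and_eq_false_iff, Bool.and_eq_false_iff]
      refine ⟨?_, ?_⟩
      · by_cases h : T.e1 = true
        · obtain ⟨h1, hr1⟩ := hTe1_iff.1 h
          left; rw [hTk1, hk1c, if_pos h1]
          have : k ≠ k₁ := fun hk' => hr0 (hk' ▸ hr1)
          simpa using this
        · right; simpa using h
      · by_cases h : T.e2 = true
        · obtain ⟨h2, hr2⟩ := hTe2_iff.1 h
          left; rw [hk2_val.1 h2]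
          have : k ≠ k₂ := fun hk' => hr0 (hk' ▸ hr2)
          simpa using this
        · right; simpa using h
  -- the centre code
  have hκ20 : κ ≤ L → κ + c κ = 20 := fun hκ => by
    have h := (hcen κ hκ).2 rfl
    have : (x + κ * p) / n = 20 := Nat.div_eq_of_lt_le (by omega) (by omega)
    rw [(hdm κ).1] at this; exact this
  have hTkap : (κ ≤ L → T.kap = κ) ∧ (¬ κ ≤ L → T.kap = L + 1) := by
    have hkap : T.kap = (if kcc = 0 then 38 + u + 1 else if 18 + carryRaw (c 0) k1c T.k2 18 = 20 then 18
        else if 19 + carryRaw (c 0) k1c T.k2 19 = 20 then 19 else if 20 + carryRaw (c 0) k1c T.k2 20 = 20 then 20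
        else 38 + u + 1) := rfl
    have hcr : ∀ k, k ≤ L → carryRaw (c 0) k1c T.k2 k = c k := fun k hk => by
      rw [← hTcarry k hk]; rfl
    refine ⟨fun hκ => ?_, fun hκ => ?_⟩
    · have h20 := hκ20 hκ
      have m18 := cmono (show 18 ≤ 19 by norm_num)
      have m19 := cmono (show 19 ≤ 20 by norm_num)
      rw [hkap, hkcc, if_pos hκ, if_neg (by norm_num), hcr 18 (by omega), hcr 19 (by omega), hcr 20 (by omega)]
      have hcκ := (cmono (show κ ≤ L from hκ)).trans hcL
      rcases (show κ = 18 ∨ κ = 19 ∨ κ = 20 by omega) with h | h | h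
      · rw [h] at h20 ⊢; rw [if_pos (by omega)]
      · rw [h] at h20 ⊢
        have := cmono (show 18 ≤ 19 by norm_num)
        rw [if_neg (by omega), if_pos (by omega)]
      · rw [h] at h20 ⊢
        rw [if_neg (by omega), if_neg (by omega), if_pos (by omega)]
    · rw [hkap, hkcc, if_neg hκ, if_pos rfl]; omega
  -- ### assembling
  refine ⟨c 0, u, k1c, dc, e1c, e2c, kcc, hc0, by omega, by rw [he1c]; split_ifs <;> omega,
    by rw [he2c]; split_ifs <;> omega, by rw [hkcc]; split_ifs <;> omega, ?_, ?_, hTL, ?_, ?_⟩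
  · -- the three codings
    by_cases h1 : k₁ ≤ L
    · by_cases h2 : k₂ ≤ L
      · have := hsp h2
        refine Or.inr (Or.inr ⟨?_, ?_⟩)
        · rw [hk1c, if_pos h1]; omega
        · rw [hdc, if_pos h2]; omega
      · exact Or.inr (Or.inl ⟨by rw [hk1c, if_pos h1]; omega, by rw [hdc, if_neg h2],
          by rw [he2c, if_neg (fun h => h2 h.1)]⟩)
    · have h2 : ¬ k₂ ≤ L := fun h => h1 (hk₁₂.trans h)
      exact Or.inl ⟨by rw [hk1c, if_neg h1], by rw [hdc, if_neg h2], by rw [he1c, if_neg (fun h => h1 h.1)],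
        by rw [he2c, if_neg (fun h => h2 h.1)]⟩
  · -- the constraints
    refine N52_intro T hc0 ?_ ?_ ?_ ?_ ?_ ?_ ?_ ?_ ?_ (fun h => by rw [hTL, hk1_le L le_rfl]; exact (hTe1_iff.1 h).1)
      (fun h => by rw [hTL, hk2_le L le_rfl]; exact (hTe2_iff.1 h).1)
    · rw [hTL, hk2_le L le_rfl, hk1_le L le_rfl]; exact fun h => hk₁₂.trans h
    · rw [hTL, hk1_le L le_rfl, hTk1, hk1c]; intro h; rw [if_pos h]; exact hk₁1
    · rw [hTL, hk2_le L le_rfl]; intro h2; rw [hk2_val.1 h2, hTk1, hk1c, if_pos (hk₁₂.trans h2)]; exact hsp h2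
    · rw [hTc0, hTL, hk1_le L le_rfl, hTk1, hk1c]; intro h0 h1; rw [if_pos h1]
      by_contra hlt
      have := above1 k₁ le_rfl h1
      have := cmono (show k₁ ≤ 23 by omega)
      have := hc23 h0
      omega
    · rw [hTL, hTcarry L le_rfl]; exact hβL41
    · rw [hTL, hTcarry L le_rfl]; exact hβL39
    · rw [hTL, hTcarry L le_rfl]; intro h41
      have hge : 41 * n ≤ x + L * p := by
        have := Nat.div_mul_le_self (x + L * p) n
        rw [hβL, h41] at this; linarith
      have hrL : r L = 0 := by
        rw [← (hdm L).2, show x + L * p = 41 * n by omega, Nat.mul_mod_left]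
      rcases hflag L (by omega) le_rfl hrL with h | h
      · by_cases h2 : k₂ = L
        · left; exact ⟨by rw [hk2_val.1 (by omega), h2], hTe2_iff.2 ⟨by omega, h2 ▸ hrL⟩⟩
        · right
          have hk2L : ¬ k₂ ≤ L := fun h' => h2 (le_antisymm h' (h ▸ hk₁₂))
          exact ⟨by rw [hTk1, hk1c, if_pos (by omega), h], hTe1_iff.2 ⟨by omega, h ▸ hrL⟩,
            by rw [hk2_val.2 hk2L]; omega⟩
      · left; exact ⟨by rw [hk2_val.1 (by omega), h], hTe2_iff.2 ⟨by omega, h ▸ hrL⟩⟩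
    · rw [hTL, hTcarry L le_rfl]; intro h39
      have hj : c (L + 1) = c L + 1 := by have := cstep L; omega
      have hconst : c (L - 23) = c L := by
        have := c24 (L - 23)
        rw [show L - 23 + 24 = L + 1 by omega] at this
        exact le_antisymm (cmono (by omega)) (by omega)
      have eL := hrep L le_rfl
      have eM := hrep (L - 23) (by omega)
      refine ⟨by omega, fun h2 => ?_, fun h2 h1 => ?_⟩
      · rw [hk2_le L le_rfl] at h2; rw [hk2_val.1 h2]
        have h1 : k₁ ≤ L := hk₁₂.trans h2
        rw [if_pos h1, if_pos h2] at eL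
        by_contra hlt
        rw [if_neg (show ¬ k₂ ≤ L - 23 by omega)] at eM
        split_ifs at eM <;> omega
      · rw [hk2_le L le_rfl] at h2; rw [hk1_le L le_rfl] at h1
        rw [hTk1, hk1c, if_pos h1]
        rw [if_pos h1, if_neg h2] at eL
        by_contra hlt
        rw [if_neg (show ¬ k₁ ≤ L - 23 by omega), if_neg (show ¬ k₂ ≤ L - 23 by omega)] at eM
        omega
    · intro hk
      have hκ : κ ≤ L := by by_contra h; rw [hTkap.2 h, hTL] at hk; omega
      rw [hTkap.1 hκ, hTcarry κ hκ]; exact hκ20 hκ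
  · -- the type list
    have hLb : x + L * p ≤ (bRec n 0).toNat := by rw [hb0]; exact hL
    have hLb' : (bRec n 0).toNat < x + L * p + p := by rw [hb0]; exact hL'
    rw [classTypeList_level (bRec n) hLb hLb', F52, hTL]
    refine List.map_congr_left fun k hk => ?_
    have hkL : k ≤ L := by have := List.mem_range.1 hk; omega
    have hs : x + k * p ≤ 41 * n := by have := Nat.mul_le_mul_right p hkL; omega
    rw [netExp_bRec_eq hn1 hs, (hdm k).1, (hdm k).2, hTcarry k hkL]
    congr 1
    · rcases Nat.eq_zero_or_pos k with h0 | hpos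
      · subst h0; exact brVal_flag_irrel (by omega) _ _
      · rw [hTflag k hpos hkL]
    · by_cases hκ : κ ≤ L
      · rw [hTkap.1 hκ]; exact if_congr (hcen k hkL) rfl rfl
      · rw [hTkap.2 hκ, if_neg (show ¬ (k = L + 1) by omega), if_neg (fun h => ?_)]
        have := (hcen k hkL).1 h; omega
  · -- the centre code
    constructor
    · intro hk
      have hκ : κ ≤ L := by by_contra h; rw [hTkap.2 h] at hk; omega
      exact ⟨κ, hκ, (hcen κ hκ).2 rfl⟩
    · rintro ⟨k, hk, h⟩
      have hkκ := (hcen k hk).1 h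
      have hκ : κ ≤ L := by omega
      rw [hTkap.1 hκ]; exact hκ

end Cls

end Summit.KontsevichZagierPeriods.Zeta5Search.LongClass
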